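import Literature.AlgebraicGeometry.Motives.HodgeStructureLefschetzGroupCenterSigns
import Literature.AlgebraicGeometry.Motives.HodgeStructureHodgeGroupCenterFinite
import Literature.AlgebraicGeometry.Motives.HodgeStructureStableSubHodgeStructuresCanonicalDecomposition
import Literature.AlgebraicGeometry.Motives.HodgeStructureCentralizerInternalBlocks
import HarnessLib

/-!
# FIRST KIND: A CENTRAL `γ ∈ S(A)(ℚ)` IS `diag(±1)` ON `V = ⊕_S S` — ITS `±1`-EIGENSPACES ARE THE SUMS OF THE SIMPLE FACTORS WITH
# SIGN `±1`, `V = V₊(γ) ⊕ V₋(γ)` `ψ`-ORTHOGONALLY INTO `E_φ`-STABLE SUB-HODGE STRUCTURES, `γ ↦ V₋(γ)` IS A BIJECTION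
# `Z(S(H)(ℚ)) ≅ {E_φ-stable sub-Hodge structures}`, AND `Z(Hg(H)(ℚ))` EMBEDS INTO THE SIGN VECTORS
# (Milne 1999 §1 p. 645 `S₀ = U_{C₀} = μ₂^t`; Moonen–Zarhin 1998 §1 Lemma (1), «Z(Hdg) ⊂ U_E»)

[topic AlgebraicGeometry/Motives]

Layer `Literature/AlgebraicGeometry/Motives`, lane `lit-hodgefound` (Track 2 foundations library; prover seat
`lit-hodgefound-p02`, generation 55, self-proposed row g55-#4). THEOREMS ONLY: no definition, no named fact (net debt `0`),
no instance, no notation.  Sequel of g55-#1 (`Motives/HodgeStructureLefschetzGroupCenterSigns`: for `†` of the first kind a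
central `γ ∈ S(H)(ℚ)` acts on each canonical block `S` by a sign `ε_S(γ)`, and `Z(S(H)(ℚ)) ≃* ({blocks} → ℤˣ)`).  Milne (p. 645):
`S₀(A) = {γ ∈ C₀ | γ†γ = 1}` inside `C₀ = K₁ × ⋯ × K_t`, one factor per simple isogeny class; for `†` trivial on `C₀` an element
of `S₀(ℚ) = {±1}^t` IS the block-diagonal operator `diag(ε₁, …, ε_t)` on `V = ⊕_k V_k`.  This file spells out that operator:
(i) on each canonical block `γ` is `+1` or `−1`; the `ε`-eigenspace of `γ` (`ε = ±1`) is EXACTLY the sum of the canonical blocks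
on which `γ = ε` (decompose `v = Σ_S π_S v` with the Hodge projectors `π_S ∈ E_φ`, which commute with `γ ∈ C(H)`);
(ii) `V = V₊(γ) ⊕ V₋(γ)`, the two eigenspaces are `ψ`-ORTHOGONAL (`γ` preserves `ψ`), `E_φ`-STABLE (`γ` commutes with `E_φ`),
and underlie sub-Hodge structures (sums of canonical blocks);
(iii) `γ ↦ V₋(γ)` is a BIJECTION from `Z(S(H)(ℚ))` onto the `E_φ`-stable sub-Hodge structures of `H` (every stable sub-Hodge
structure is a sum of canonical blocks, the tree's `Polarization.toSubmodule_eq_iSup_minimal_stable_le`; every sign vector is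
realised exactly once, g55-#1) — «`S₀(ℚ) = μ₂^t` = the power set of the set of simple factors»;
(iv) «`Z(Hdg) ⊂ U_E`»: restriction gives an INJECTIVE homomorphism `Z(Hg(H)(ℚ)) →* ({blocks} → ℤˣ)` with `γ v = (f γ S) • v`
— a central element of the Hodge group acts on every simple factor by a sign.

## The sources, verbatim

* J. S. Milne, *Lefschetz classes on abelian varieties*, Duke Math. J. 96 (1999) 639–675 [Milne1999LefschetzClasses] (held
  `paper:doi-10-1215-s0012-7094-99-09620-5`, folios 6–7): p. 644 L16–L20 "`S(A)(R) = {γ ∈ C(A) ⊗_k R | γ†γ = 1}`. Thus, for any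
  ample divisor `D` on `A`, `S(A)` is the largest algebraic subgroup of `Sp(e_D)` whose elements commute with the endomorphisms
  of `A`"; p. 645 L1–L6 "`C₀(A)` […] is a product of fields […]. Every Rosati involution `†` preserves each factor of `C₀(A)`
  […] `S₀(A)(R) = {γ ∈ C₀(A) ⊗_ℚ R | γ†γ = 1}`"; Prop. 1.5 p. 644 («`S(A₁) × ⋯ × S(A_s) → S(A)`»).
* B. J. J. Moonen, Yu. G. Zarhin, *Weil classes on abelian varieties*, J. reine angew. Math. 496 (1998) 83–92
  [MoonenZarhin1998WeilClasses] (held `paper:arxiv-alg-geom_9612017`, chunk p0002): «Lemma. (1) The center of `G_div(X)` is the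
  group `U_{K_B}` […] in all other cases it is finite», and, in the proof of (2) ⟹ (3), «`Z(Hdg) ⊂ U_E`».
* H. Lange, *Abelian Varieties over the Complex Numbers* (2023) [Lange2023AbelianVarietiesComplex], §2.4.4 Cor. 2.4.26 (the
  simple factors and `End_ℚ(X) ≅ ⊕ M_{n_i}(F_i)`), §2.6.2 Lemma 2.6.4 (first kind).

Nearest tree results, BY NAME: g55-#1 `Polarization.exists_forall_apply_eq_smul_of_mem_center_lefschetzGroup`,
`Polarization.existsUnique_mem_center_lefschetzGroup_forall_apply_eq_smul`, `Polarization.eq_of_forall_exists_forall_apply_eq_smul`,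
`Polarization.exists_mulEquiv_center_lefschetzGroup_pi_units`; g54-#11 `Polarization.exists_center_hodgeGroup_monoidHom_injective`;
`Polarization.isInternal_minimal_stable`, `Polarization.toSubmodule_eq_iSup_minimal_stable_le`, `isInternalProj` (+ API),
`isInternalProj_mem_endAlg'`.  Here: the eigenspace description, the splitting, the bijection with stable sub-Hodge structures,
and the Hodge-group sign characters.

## Dictionary and what is proved (namespace `Literature.AlgebraicGeometry.Motives.HodgeStructure`)

`S(H)(ℚ) = ψ.lefschetzGroup`, `Hg(H)(ℚ) = H.hodgeGroup` (under the tree's standing `[HodgeTensorFacts]`), `Z(·) = Subgroup.center`,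
`V_ε(γ) = Module.End.eigenspace ↑γ ε`, "first kind" = `∀ z ∈ Z(E_φ), z† = z`; a canonical block = a minimal non-zero `E_φ`-stable
`S : SubHodgeStructure H` (the tree's predicate, verbatim).

* §1 **`Polarization.forall_apply_eq_self_or_forall_apply_eq_neg_of_mem_center_lefschetzGroup`** (on a canonical block `γ = 1` or
  `γ = -1`).
* §2 **`Polarization.eigenspace_eq_iSup_minimal_stable_of_mem_center_lefschetzGroup`** (`V_ε(γ) = ⨆ {S canonical | γ|_S = ε}`,
  `ε = ±1`), **`Polarization.eigenspace_one_eq_iSup_of_mem_center_lefschetzGroup`**,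
  **`Polarization.eigenspace_neg_one_eq_iSup_of_mem_center_lefschetzGroup`**.
* §3 **`Polarization.isCompl_eigenspace_one_neg_one_of_mem_center_lefschetzGroup`** (`V = V₊ ⊕ V₋`),
  **`Polarization.form_eq_zero_of_mem_eigenspace_one_of_mem_eigenspace_neg_one`** (`ψ(V₊, V₋) = 0`, any `γ ∈ S(H)(ℚ)`),
  **`Polarization.apply_mem_eigenspace_of_mem_lefschetzGroup`** (`V_c(γ)` is `E_φ`-stable, any `γ ∈ S(H)(ℚ)`),
  **`Polarization.exists_subHodgeStructure_toSubmodule_eq_eigenspace`** (`V_ε(γ)` underlies an `E_φ`-stable sub-Hodge structure).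
* §4 **`Polarization.exists_mem_center_lefschetzGroup_eigenspace_neg_one_eq`** (every `E_φ`-stable sub-Hodge structure is
  `V₋(γ)` for exactly one central `γ`), **`Polarization.eq_of_eigenspace_neg_one_eq`** (`γ ↦ V₋(γ)` is injective on the centre).
* §5 **`Polarization.exists_center_hodgeGroup_monoidHom_pi_units_injective`** (`Z(Hg(H)(ℚ)) ↪ ({blocks} → ℤˣ)` with formula),
  **`Polarization.exists_forall_apply_eq_smul_of_mem_center_hodgeGroup`** (a central element of `Hg` is `±1` on each block).
-/

noncomputable section

namespace Literature.AlgebraicGeometry.Motives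

namespace HodgeStructure

universe u

variable {V : Type u} [AddCommGroup V] [Module ℚ V] [Module.Finite ℚ V] {n : ℤ} {H : HodgeStructure V n}

/-! ## §1 On a canonical block a central `γ` is `+1` or `−1` -/

/-- **ON EACH CANONICAL BLOCK A CENTRAL `γ ∈ S(H)(ℚ)` IS `+1` OR `−1`** (`†` of the first kind; g55-#1's sign `ε_S(γ) ∈ ℤˣ = {±1}`).
[cite: Milne1999LefschetzClasses, §1 p. 645 L1–L6 and §2 Summary p. 652] [cite: Lange2023AbelianVarietiesComplex, §2.4.4 Cor. 2.4.26 and §2.6.2 Lemma 2.6.4] -/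
theorem Polarization.forall_apply_eq_self_or_forall_apply_eq_neg_of_mem_center_lefschetzGroup (ψ : Polarization H)
    (hfix : ∀ z : H.endAlg, z ∈ Subalgebra.center ℚ H.endAlg → ψ.adjoint (z : Module.End ℚ V) = z)
    {γ : ψ.lefschetzGroup} (hγ : γ ∈ Subgroup.center ψ.lefschetzGroup) {S : SubHodgeStructure H}
    (hS : (∀ a ∈ H.endAlg, ∀ v ∈ S.toSubmodule, a v ∈ S.toSubmodule) ∧ S.toSubmodule ≠ ⊥ ∧
      ∀ S' : SubHodgeStructure H, (∀ a ∈ H.endAlg, ∀ v ∈ S'.toSubmodule, a v ∈ S'.toSubmodule) →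
        S'.toSubmodule ≤ S.toSubmodule → S'.toSubmodule = ⊥ ∨ S'.toSubmodule = S.toSubmodule) :
    (∀ v ∈ S.toSubmodule, (γ : V ≃ₗ[ℚ] V) v = v) ∨ ∀ v ∈ S.toSubmodule, (γ : V ≃ₗ[ℚ] V) v = -v := by
  obtain ⟨ε, hε⟩ := ψ.exists_forall_apply_eq_smul_of_mem_center_lefschetzGroup hfix hγ hS
  rcases Int.units_eq_one_or ε with rfl | rfl
  · exact Or.inl fun v hv => by rw [hε v hv, Units.val_one, one_zsmul]
  · exact Or.inr fun v hv => by rw [hε v hv, Units.val_neg, Units.val_one, neg_one_zsmul]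

/-! ## §2 The `±1`-eigenspaces of a central `γ` are the sums of the canonical blocks with sign `±1` -/

omit [Module.Finite ℚ V] in
/-- `w = -w ⟹ w = 0` in a `ℚ`-vector space. [folklore] -/
private theorem eq_zero_of_eq_neg₅₅₄ {w : V} (hw : w = -w) : w = 0 := by
  have h2 : (2 : ℚ) • w = 0 := by rw [two_smul]; nth_rewrite 2 [hw]; exact add_neg_cancel w
  exact (smul_eq_zero.1 h2).resolve_left two_ne_zero

/-- **`V_ε(γ) = ⨆ {S canonical | γ|_S = ε}` FOR A CENTRAL `γ` AND `ε = ±1`** (`†` of the first kind): the `ε`-eigenspace of `γ`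
is the sum of the canonical blocks on which `γ` acts as `ε` — `⊇` is clear; for `⊆` write `v = Σ_S π_S v` along `V = ⊕_S S`
(the tree's `Polarization.isInternal_minimal_stable`) with the Hodge projectors `π_S ∈ E_φ`, which commute with `γ ∈ C(H)`:
`π_S v = π_S (ε⁻¹ γ v)`-wise, `γ (π_S v) = π_S (γ v) = ε π_S v` while `γ = ε_S` on `S`, so `π_S v = 0` unless `ε_S = ε`.  This is
`γ = diag(ε₁, …, ε_t)` on `V = ⊕ V_k`. [cite: Milne1999LefschetzClasses, §1 p. 645 L1–L6 (S₀ ⊂ C₀ = Π K_k) and Prop. 1.5]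
[cite: Lange2023AbelianVarietiesComplex, §2.4.4 Cor. 2.4.26] -/
theorem Polarization.eigenspace_eq_iSup_minimal_stable_of_mem_center_lefschetzGroup (ψ : Polarization H)
    (hfix : ∀ z : H.endAlg, z ∈ Subalgebra.center ℚ H.endAlg → ψ.adjoint (z : Module.End ℚ V) = z)
    {γ : ψ.lefschetzGroup} (hγ : γ ∈ Subgroup.center ψ.lefschetzGroup) (ε : ℤˣ) :
    Module.End.eigenspace ((γ : V ≃ₗ[ℚ] V) : Module.End ℚ V) ((ε : ℤ) : ℚ) =
      ⨆ (S : SubHodgeStructure H) (_ : ((∀ a ∈ H.endAlg, ∀ v ∈ S.toSubmodule, a v ∈ S.toSubmodule) ∧ S.toSubmodule ≠ ⊥ ∧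
        ∀ S' : SubHodgeStructure H, (∀ a ∈ H.endAlg, ∀ v ∈ S'.toSubmodule, a v ∈ S'.toSubmodule) →
          S'.toSubmodule ≤ S.toSubmodule → S'.toSubmodule = ⊥ ∨ S'.toSubmodule = S.toSubmodule) ∧
        ∀ v ∈ S.toSubmodule, (γ : V ≃ₗ[ℚ] V) v = (ε : ℤ) • v), S.toSubmodule := by
  classical
  refine le_antisymm (fun v hv => ?_) (iSup₂_le fun S hS v hv => ?_)
  · -- `⊆`: decompose `v` along `V = ⊕_S S` over the canonical blocks
    rw [Module.End.mem_eigenspace_iff, LinearEquiv.coe_coe, Int.cast_smul_eq_zsmul] at hv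
    haveI : Fintype {S : SubHodgeStructure H // (∀ a ∈ H.endAlg, ∀ v ∈ S.toSubmodule, a v ∈ S.toSubmodule) ∧ S.toSubmodule ≠ ⊥ ∧
        ∀ S' : SubHodgeStructure H, (∀ a ∈ H.endAlg, ∀ v ∈ S'.toSubmodule, a v ∈ S'.toSubmodule) →
          S'.toSubmodule ≤ S.toSubmodule → S'.toSubmodule = ⊥ ∨ S'.toSubmodule = S.toSubmodule} :=
      ψ.finite_setOf_minimal_stable.fintype
    have hW := ψ.isInternal_minimal_stable
    rw [← sum_isInternalProj_apply hW Finset.univ (fun j hj => absurd (Finset.mem_univ j) hj) v]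
    refine Submodule.sum_mem _ fun S _ => ?_
    -- the sign of `γ` on the block `S`
    obtain ⟨εS, hεS⟩ := ψ.exists_forall_apply_eq_smul_of_mem_center_lefschetzGroup hfix hγ S.2
    -- `γ` commutes with the Hodge projector `π_S`
    have hcomm : (γ : V ≃ₗ[ℚ] V) (isInternalProj hW S v) = isInternalProj hW S ((γ : V ≃ₗ[ℚ] V) v) :=
      (((ψ.mem_lefschetzGroup_iff _).1 γ.2).1 ⟨_, isInternalProj_mem_endAlg' _ hW S⟩ v).symm
    by_cases hε : εS = ε
    · subst hε
      exact Submodule.mem_iSup_of_mem (S : SubHodgeStructure H)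
        (Submodule.mem_iSup_of_mem ⟨S.2, hεS⟩ (isInternalProj_apply_mem hW S v))
    · -- `ε_S ≠ ε`: then `ε_S = -ε`-wise `π_S v = -π_S v`, so `π_S v = 0`
      have h1 : (εS : ℤ) • isInternalProj hW S v = (ε : ℤ) • isInternalProj hW S v := by
        rw [← hεS _ (isInternalProj_apply_mem hW S v), hcomm, hv, map_zsmul]
      have h0 : isInternalProj hW S v = 0 := by
        rcases Int.units_eq_one_or εS with h2 | h2 <;> rcases Int.units_eq_one_or ε with h3 | h3
        · exact absurd (h2.trans h3.symm) hε
        · rw [h2, h3, Units.val_one, one_zsmul, Units.val_neg, Units.val_one, neg_one_zsmul] at h1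
          exact eq_zero_of_eq_neg₅₅₄ h1
        · rw [h2, h3, Units.val_one, one_zsmul, Units.val_neg, Units.val_one, neg_one_zsmul] at h1
          exact eq_zero_of_eq_neg₅₅₄ h1.symm
        · exact absurd (h2.trans h3.symm) hε
      rw [h0]
      exact Submodule.zero_mem _
  · -- `⊇`
    rw [Module.End.mem_eigenspace_iff, LinearEquiv.coe_coe, hS.2 v hv, Int.cast_smul_eq_zsmul]

/-- **`V₊(γ) = ⨆ {S canonical | γ|_S = id}`**: the fixed space of a central `γ ∈ S(H)(ℚ)` (`†` of the first kind) is the sum of the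
canonical blocks fixed pointwise by `γ`. [cite: Milne1999LefschetzClasses, §1 p. 645 L1–L6 and Prop. 1.5] [cite: Lange2023AbelianVarietiesComplex, §2.4.4 Cor. 2.4.26] -/
theorem Polarization.eigenspace_one_eq_iSup_of_mem_center_lefschetzGroup (ψ : Polarization H)
    (hfix : ∀ z : H.endAlg, z ∈ Subalgebra.center ℚ H.endAlg → ψ.adjoint (z : Module.End ℚ V) = z)
    {γ : ψ.lefschetzGroup} (hγ : γ ∈ Subgroup.center ψ.lefschetzGroup) :
    Module.End.eigenspace ((γ : V ≃ₗ[ℚ] V) : Module.End ℚ V) 1 =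
      ⨆ (S : SubHodgeStructure H) (_ : ((∀ a ∈ H.endAlg, ∀ v ∈ S.toSubmodule, a v ∈ S.toSubmodule) ∧ S.toSubmodule ≠ ⊥ ∧
        ∀ S' : SubHodgeStructure H, (∀ a ∈ H.endAlg, ∀ v ∈ S'.toSubmodule, a v ∈ S'.toSubmodule) →
          S'.toSubmodule ≤ S.toSubmodule → S'.toSubmodule = ⊥ ∨ S'.toSubmodule = S.toSubmodule) ∧
        ∀ v ∈ S.toSubmodule, (γ : V ≃ₗ[ℚ] V) v = v), S.toSubmodule := by
  have h := ψ.eigenspace_eq_iSup_minimal_stable_of_mem_center_lefschetzGroup hfix hγ 1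
  simp only [Units.val_one, Int.cast_one, one_zsmul] at h
  exact h

/-- **`V₋(γ) = ⨆ {S canonical | γ|_S = -id}`**: the `−1`-eigenspace of a central `γ ∈ S(H)(ℚ)` (`†` of the first kind) is the sum
of the canonical blocks on which `γ = -1`. [cite: Milne1999LefschetzClasses, §1 p. 645 L1–L6 and Prop. 1.5] [cite: Lange2023AbelianVarietiesComplex, §2.4.4 Cor. 2.4.26] -/
theorem Polarization.eigenspace_neg_one_eq_iSup_of_mem_center_lefschetzGroup (ψ : Polarization H)
    (hfix : ∀ z : H.endAlg, z ∈ Subalgebra.center ℚ H.endAlg → ψ.adjoint (z : Module.End ℚ V) = z)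
    {γ : ψ.lefschetzGroup} (hγ : γ ∈ Subgroup.center ψ.lefschetzGroup) :
    Module.End.eigenspace ((γ : V ≃ₗ[ℚ] V) : Module.End ℚ V) (-1) =
      ⨆ (S : SubHodgeStructure H) (_ : ((∀ a ∈ H.endAlg, ∀ v ∈ S.toSubmodule, a v ∈ S.toSubmodule) ∧ S.toSubmodule ≠ ⊥ ∧
        ∀ S' : SubHodgeStructure H, (∀ a ∈ H.endAlg, ∀ v ∈ S'.toSubmodule, a v ∈ S'.toSubmodule) →
          S'.toSubmodule ≤ S.toSubmodule → S'.toSubmodule = ⊥ ∨ S'.toSubmodule = S.toSubmodule) ∧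
        ∀ v ∈ S.toSubmodule, (γ : V ≃ₗ[ℚ] V) v = -v), S.toSubmodule := by
  have h := ψ.eigenspace_eq_iSup_minimal_stable_of_mem_center_lefschetzGroup hfix hγ (-1)
  simp only [Units.val_neg, Units.val_one, Int.cast_neg, Int.cast_one, neg_one_zsmul] at h
  exact h

/-! ## §3 `V = V₊(γ) ⊕ V₋(γ)`, `ψ`-orthogonally, into `E_φ`-stable sub-Hodge structures -/

/-- **`V = V₊(γ) ⊕ V₋(γ)` FOR A CENTRAL `γ ∈ S(H)(ℚ)`** (`†` of the first kind): `γ² = 1` (g54-#5), so `v = ½(v + γv) + ½(v − γv)`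
and `V₊ ∩ V₋ = 0`. [cite: Milne1999LefschetzClasses, §1 p. 645 L1–L6 and §2 p. 646 L10–L16] [cite: Lange2023AbelianVarietiesComplex, §2.6.2 Lemma 2.6.4] -/
theorem Polarization.isCompl_eigenspace_one_neg_one_of_mem_center_lefschetzGroup (ψ : Polarization H)
    (hfix : ∀ z : H.endAlg, z ∈ Subalgebra.center ℚ H.endAlg → ψ.adjoint (z : Module.End ℚ V) = z)
    {γ : ψ.lefschetzGroup} (hγ : γ ∈ Subgroup.center ψ.lefschetzGroup) :
    IsCompl (Module.End.eigenspace ((γ : V ≃ₗ[ℚ] V) : Module.End ℚ V) 1)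
      (Module.End.eigenspace ((γ : V ≃ₗ[ℚ] V) : Module.End ℚ V) (-1)) := by
  have hsq : ∀ v, (γ : V ≃ₗ[ℚ] V) ((γ : V ≃ₗ[ℚ] V) v) = v := fun v => by
    have h := LinearMap.congr_fun (ψ.coe_mul_coe_eq_one_of_mem_center_lefschetzGroup hfix hγ) v
    simpa only [Module.End.mul_apply, LinearEquiv.coe_coe, Module.End.one_apply] using h
  refine ⟨Submodule.disjoint_def.2 fun v hv hv' => ?_, codisjoint_iff.2 (Submodule.eq_top_iff'.2 fun v => ?_)⟩
  · rw [Module.End.mem_eigenspace_iff, LinearEquiv.coe_coe, one_smul] at hv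
    rw [Module.End.mem_eigenspace_iff, LinearEquiv.coe_coe, neg_one_smul, hv] at hv'
    exact eq_zero_of_eq_neg₅₅₄ hv'
  · have hdec : v = (1 / 2 : ℚ) • (v + (γ : V ≃ₗ[ℚ] V) v) + (1 / 2 : ℚ) • (v - (γ : V ≃ₗ[ℚ] V) v) := by
      rw [← smul_add, add_add_sub_cancel, ← two_smul ℚ v, smul_smul]; norm_num
    rw [hdec]
    refine Submodule.add_mem _ (Submodule.mem_sup_left (Submodule.smul_mem _ _ ?_))
      (Submodule.mem_sup_right (Submodule.smul_mem _ _ ?_))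
    · rw [Module.End.mem_eigenspace_iff, LinearEquiv.coe_coe, one_smul, map_add, hsq, add_comm]
    · rw [Module.End.mem_eigenspace_iff, LinearEquiv.coe_coe, neg_one_smul, map_sub, hsq, neg_sub]

omit [Module.Finite ℚ V] in
/-- **`ψ(V₊(γ), V₋(γ)) = 0` FOR EVERY `γ ∈ S(H)(ℚ)`**: `γ` preserves `ψ` («`S(A)` is the largest algebraic subgroup of `Sp(e_D)` whose
elements commute with the endomorphisms»), so `ψ(v, w) = ψ(γv, γw) = ψ(v, -w) = -ψ(v, w)` for `γv = v`, `γw = -w`.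
[cite: Milne1999LefschetzClasses, §1 p. 644 L16–L20] -/
theorem Polarization.form_eq_zero_of_mem_eigenspace_one_of_mem_eigenspace_neg_one (ψ : Polarization H)
    {γ : V ≃ₗ[ℚ] V} (hγ : γ ∈ ψ.lefschetzGroup) {v w : V}
    (hv : v ∈ Module.End.eigenspace (γ : Module.End ℚ V) 1) (hw : w ∈ Module.End.eigenspace (γ : Module.End ℚ V) (-1)) :
    ψ.form v w = 0 := by
  rw [Module.End.mem_eigenspace_iff, LinearEquiv.coe_coe, one_smul] at hv
  rw [Module.End.mem_eigenspace_iff, LinearEquiv.coe_coe, neg_one_smul] at hw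
  have h := ((ψ.mem_lefschetzGroup_iff γ).1 hγ).2 v w
  rw [hv, hw, map_neg] at h
  have h2 : (2 : ℚ) * ψ.form v w = 0 := by linear_combination -h
  exact (mul_eq_zero.1 h2).resolve_left two_ne_zero

omit [Module.Finite ℚ V] in
/-- **THE EIGENSPACES OF `γ ∈ S(H)(ℚ)` ARE `E_φ`-STABLE**: `γ ∈ C(H)` commutes with every Hodge endomorphism `a ∈ E_φ`, so `a`
preserves `V_c(γ)` for every `c`. [cite: Milne1999LefschetzClasses, §1 p. 644 L16–L20 («whose elements commute with the endomorphisms of A»)] -/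
theorem Polarization.apply_mem_eigenspace_of_mem_lefschetzGroup (ψ : Polarization H) {γ : V ≃ₗ[ℚ] V}
    (hγ : γ ∈ ψ.lefschetzGroup) (c : ℚ) {a : Module.End ℚ V} (ha : a ∈ H.endAlg) {v : V}
    (hv : v ∈ Module.End.eigenspace (γ : Module.End ℚ V) c) : a v ∈ Module.End.eigenspace (γ : Module.End ℚ V) c := by
  rw [Module.End.mem_eigenspace_iff, LinearEquiv.coe_coe] at hv ⊢
  rw [← ((ψ.mem_lefschetzGroup_iff γ).1 hγ).1 ⟨a, ha⟩ v]
  change a (γ v) = c • a v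
  rw [hv, map_smul]

/-- **`V_ε(γ)` UNDERLIES AN `E_φ`-STABLE SUB-HODGE STRUCTURE** (central `γ`, `†` of the first kind, `ε = ±1`): it is the sum of
canonical blocks (§2), hence the underlying space of the sub-Hodge structure `⨆ S` (the tree's `SubHodgeStructure.iSup'`), and it
is `E_φ`-stable. [cite: Milne1999LefschetzClasses, §1 p. 645 L1–L6 and Prop. 1.5] [cite: VoisinHodgeI2002, §7.3.1 Def. 7.24] -/
theorem Polarization.exists_subHodgeStructure_toSubmodule_eq_eigenspace (ψ : Polarization H)
    (hfix : ∀ z : H.endAlg, z ∈ Subalgebra.center ℚ H.endAlg → ψ.adjoint (z : Module.End ℚ V) = z)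
    {γ : ψ.lefschetzGroup} (hγ : γ ∈ Subgroup.center ψ.lefschetzGroup) (ε : ℤˣ) :
    ∃ W : SubHodgeStructure H, W.toSubmodule = Module.End.eigenspace ((γ : V ≃ₗ[ℚ] V) : Module.End ℚ V) ((ε : ℤ) : ℚ) ∧
      ∀ a ∈ H.endAlg, ∀ v ∈ W.toSubmodule, a v ∈ W.toSubmodule := by
  have hWeq : (SubHodgeStructure.iSup' fun S : {S : SubHodgeStructure H //
      ((∀ a ∈ H.endAlg, ∀ v ∈ S.toSubmodule, a v ∈ S.toSubmodule) ∧ S.toSubmodule ≠ ⊥ ∧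
        ∀ S' : SubHodgeStructure H, (∀ a ∈ H.endAlg, ∀ v ∈ S'.toSubmodule, a v ∈ S'.toSubmodule) →
          S'.toSubmodule ≤ S.toSubmodule → S'.toSubmodule = ⊥ ∨ S'.toSubmodule = S.toSubmodule) ∧
        ∀ v ∈ S.toSubmodule, (γ : V ≃ₗ[ℚ] V) v = (ε : ℤ) • v} => (S : SubHodgeStructure H)).toSubmodule =
      Module.End.eigenspace ((γ : V ≃ₗ[ℚ] V) : Module.End ℚ V) ((ε : ℤ) : ℚ) := by
    rw [SubHodgeStructure.iSup'_toSubmodule, ψ.eigenspace_eq_iSup_minimal_stable_of_mem_center_lefschetzGroup hfix hγ ε,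
      iSup_subtype']
  refine ⟨_, hWeq, fun a ha v hv => ?_⟩
  rw [hWeq] at hv ⊢
  exact ψ.apply_mem_eigenspace_of_mem_lefschetzGroup γ.2 _ ha hv

/-! ## §4 `γ ↦ V₋(γ)`: `Z(S(H)(ℚ)) ≅ {E_φ-stable sub-Hodge structures}` -/

/-- **EVERY `E_φ`-STABLE SUB-HODGE STRUCTURE `W` IS `V₋(γ)` FOR EXACTLY ONE CENTRAL `γ ∈ S(H)(ℚ)`** (`†` of the first kind): `W` is
the sum of the canonical blocks it contains (the tree's `Polarization.toSubmodule_eq_iSup_minimal_stable_le`); the sign vector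
«`−1` on the blocks inside `W`, `+1` on the others» is realised by exactly one central `γ` (g55-#1), and then `V₋(γ) = W` (§2) —
«`S₀(ℚ) = μ₂^t`» read as the power set of the set of simple factors. [cite: Milne1999LefschetzClasses, §1 p. 645 L1–L14 (S₀, Prop. 1.7) and Prop. 1.5]
[cite: Lange2023AbelianVarietiesComplex, §2.4.4 Cor. 2.4.26] [cite: Lam2001FirstCourse, §22 Prop. (22.1)–(22.2) (p. 326)] -/
theorem Polarization.exists_mem_center_lefschetzGroup_eigenspace_neg_one_eq (ψ : Polarization H)
    (hfix : ∀ z : H.endAlg, z ∈ Subalgebra.center ℚ H.endAlg → ψ.adjoint (z : Module.End ℚ V) = z)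
    {W : SubHodgeStructure H} (hW : ∀ a ∈ H.endAlg, ∀ v ∈ W.toSubmodule, a v ∈ W.toSubmodule) :
    ∃! γ : ψ.lefschetzGroup, γ ∈ Subgroup.center ψ.lefschetzGroup ∧
      Module.End.eigenspace ((γ : V ≃ₗ[ℚ] V) : Module.End ℚ V) (-1) = W.toSubmodule := by
  classical
  -- the sign vector: `-1` on the canonical blocks inside `W`, `+1` elsewhere
  obtain ⟨γ, ⟨hγ, hγσ⟩, -⟩ := ψ.existsUnique_mem_center_lefschetzGroup_forall_apply_eq_smul hfix
    fun S => if S.toSubmodule ≤ W.toSubmodule then -1 else 1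
  -- on a canonical block `S`: `γ = -1` on `S` iff `S ⊆ W`
  have key : ∀ S : SubHodgeStructure H, ((∀ a ∈ H.endAlg, ∀ v ∈ S.toSubmodule, a v ∈ S.toSubmodule) ∧ S.toSubmodule ≠ ⊥ ∧
      ∀ S' : SubHodgeStructure H, (∀ a ∈ H.endAlg, ∀ v ∈ S'.toSubmodule, a v ∈ S'.toSubmodule) →
        S'.toSubmodule ≤ S.toSubmodule → S'.toSubmodule = ⊥ ∨ S'.toSubmodule = S.toSubmodule) →
      ((∀ v ∈ S.toSubmodule, (γ : V ≃ₗ[ℚ] V) v = -v) ↔ S.toSubmodule ≤ W.toSubmodule) := by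
    intro S hS
    constructor
    · intro h
      by_contra hle
      apply hS.2.1
      rw [Submodule.eq_bot_iff]
      intro v hv
      have h1 := hγσ S hS v hv
      rw [if_neg hle, Units.val_one, one_zsmul, h v hv] at h1
      exact eq_zero_of_eq_neg₅₅₄ (neg_eq_iff_eq_neg.1 h1)
    · intro hle v hv
      rw [hγσ S hS v hv, if_pos hle, Units.val_neg, Units.val_one, neg_one_zsmul]
  have hVW : Module.End.eigenspace ((γ : V ≃ₗ[ℚ] V) : Module.End ℚ V) (-1) = W.toSubmodule := by
    rw [ψ.eigenspace_neg_one_eq_iSup_of_mem_center_lefschetzGroup hfix hγ, ψ.toSubmodule_eq_iSup_minimal_stable_le hW]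
    refine le_antisymm (iSup₂_le fun S hS => ?_) (iSup₂_le fun S₀ hle => ?_)
    · exact le_iSup₂_of_le ⟨S, hS.1⟩ ((key S hS.1).1 hS.2) le_rfl
    · exact le_iSup₂_of_le (S₀ : SubHodgeStructure H) ⟨S₀.2, (key _ S₀.2).2 hle⟩ le_rfl
  refine ⟨γ, ⟨hγ, hVW⟩, ?_⟩
  -- uniqueness: the `−1`-eigenspace determines the sign on every canonical block
  rintro γ' ⟨hγ', hVW'⟩
  refine ψ.eq_of_forall_exists_forall_apply_eq_smul fun S hS => ?_
  rcases ψ.forall_apply_eq_self_or_forall_apply_eq_neg_of_mem_center_lefschetzGroup hfix hγ' hS with h' | h'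
  · -- `γ' = 1` on `S`: then `S ⊄ W` unless `S = 0`, so `γ = 1` on `S` too
    refine ⟨1, fun v hv => by rw [h' v hv, Units.val_one, one_zsmul], fun v hv => ?_⟩
    rw [Units.val_one, one_zsmul]
    rcases ψ.forall_apply_eq_self_or_forall_apply_eq_neg_of_mem_center_lefschetzGroup hfix hγ hS with h | h
    · exact h v hv
    · exfalso
      apply hS.2.1
      rw [Submodule.eq_bot_iff]
      intro w hw
      have hwW : w ∈ W.toSubmodule := (key S hS).1 h hw
      rw [← hVW', Module.End.mem_eigenspace_iff, LinearEquiv.coe_coe, neg_one_smul, h' w hw] at hwW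
      exact eq_zero_of_eq_neg₅₅₄ hwW
  · -- `γ' = -1` on `S`: then `S ⊆ V₋(γ') = W`, so `γ = -1` on `S`
    refine ⟨-1, fun v hv => by rw [h' v hv, Units.val_neg, Units.val_one, neg_one_zsmul], fun v hv => ?_⟩
    rw [Units.val_neg, Units.val_one, neg_one_zsmul]
    have hSW : S.toSubmodule ≤ W.toSubmodule := fun w hw => by
      rw [← hVW', Module.End.mem_eigenspace_iff, LinearEquiv.coe_coe, neg_one_smul]
      exact h' w hw
    exact ((key S hS).2 hSW) v hv

/-- **`γ ↦ V₋(γ)` IS INJECTIVE ON `Z(S(H)(ℚ))`** (`†` of the first kind): a central element is determined by its `−1`-eigenspace.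
[cite: Milne1999LefschetzClasses, §1 p. 645 L1–L14 and Prop. 1.5] [cite: Lange2023AbelianVarietiesComplex, §2.4.4 Cor. 2.4.26] -/
theorem Polarization.eq_of_eigenspace_neg_one_eq (ψ : Polarization H)
    (hfix : ∀ z : H.endAlg, z ∈ Subalgebra.center ℚ H.endAlg → ψ.adjoint (z : Module.End ℚ V) = z)
    {γ γ' : ψ.lefschetzGroup} (hγ : γ ∈ Subgroup.center ψ.lefschetzGroup) (hγ' : γ' ∈ Subgroup.center ψ.lefschetzGroup)
    (h : Module.End.eigenspace ((γ : V ≃ₗ[ℚ] V) : Module.End ℚ V) (-1) =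
      Module.End.eigenspace ((γ' : V ≃ₗ[ℚ] V) : Module.End ℚ V) (-1)) : γ = γ' := by
  obtain ⟨W, hW, hWst⟩ := ψ.exists_subHodgeStructure_toSubmodule_eq_eigenspace hfix hγ (-1)
  simp only [Units.val_neg, Units.val_one, Int.cast_neg, Int.cast_one] at hW
  obtain ⟨γ₀, -, huniq⟩ := ψ.exists_mem_center_lefschetzGroup_eigenspace_neg_one_eq hfix hWst
  exact (huniq γ ⟨hγ, hW.symm⟩).trans (huniq γ' ⟨hγ', h ▸ hW.symm⟩).symm

/-! ## §5 «`Z(Hdg) ⊂ U_E`»: the sign characters of the centre of the Hodge group -/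

section HodgeGroup

variable [HodgeTensorFacts.{u, u}]

/-- **A CENTRAL ELEMENT OF `Hg(H)(ℚ)` ACTS ON EVERY CANONICAL BLOCK BY A SIGN** (`†` of the first kind): it is central in `S(H)(ℚ)`
(g54-#7 `Polarization.inclusion_mem_center_lefschetzGroup`), where g55-#1 applies. [cite: MoonenZarhin1998WeilClasses, §1 («Z(Hdg) ⊂ U_E»; Lemma (1))]
[cite: Milne1999LefschetzClasses, §1 p. 645 L1–L14] -/
theorem Polarization.exists_forall_apply_eq_smul_of_mem_center_hodgeGroup (ψ : Polarization H)
    (hfix : ∀ z : H.endAlg, z ∈ Subalgebra.center ℚ H.endAlg → ψ.adjoint (z : Module.End ℚ V) = z)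
    {γ : H.hodgeGroup} (hγ : γ ∈ Subgroup.center H.hodgeGroup) {S : SubHodgeStructure H}
    (hS : (∀ a ∈ H.endAlg, ∀ v ∈ S.toSubmodule, a v ∈ S.toSubmodule) ∧ S.toSubmodule ≠ ⊥ ∧
      ∀ S' : SubHodgeStructure H, (∀ a ∈ H.endAlg, ∀ v ∈ S'.toSubmodule, a v ∈ S'.toSubmodule) →
        S'.toSubmodule ≤ S.toSubmodule → S'.toSubmodule = ⊥ ∨ S'.toSubmodule = S.toSubmodule) :
    ∃ ε : ℤˣ, ∀ v ∈ S.toSubmodule, (γ : V ≃ₗ[ℚ] V) v = (ε : ℤ) • v :=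
  ψ.exists_forall_apply_eq_smul_of_mem_center_lefschetzGroup hfix (ψ.inclusion_mem_center_lefschetzGroup hγ) hS

/-- **«`Z(Hdg) ⊂ U_E = μ₂^t`»: AN INJECTIVE HOMOMORPHISM `Z(Hg(H)(ℚ)) →* ({canonical blocks} → ℤˣ)` WITH `γ v = (f γ S) • v` ON EACH
BLOCK** (`†` of the first kind) — the composite of `Z(Hg(H)(ℚ)) ↪ Z(S(H)(ℚ))` (g54-#11) with the sign isomorphism of g55-#1; so
`Z(Hg(H)(ℚ))` is an elementary abelian `2`-group read off block by block. [cite: MoonenZarhin1998WeilClasses, §1 («Z(Hdg) ⊂ U_E»; Lemma (1))]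
[cite: Milne1999LefschetzClasses, §1 p. 645 L1–L14 and §2 Summary p. 652] -/
theorem Polarization.exists_center_hodgeGroup_monoidHom_pi_units_injective (ψ : Polarization H)
    (hfix : ∀ z : H.endAlg, z ∈ Subalgebra.center ℚ H.endAlg → ψ.adjoint (z : Module.End ℚ V) = z) :
    ∃ f : Subgroup.center H.hodgeGroup →*
        ({S : SubHodgeStructure H // (∀ a ∈ H.endAlg, ∀ v ∈ S.toSubmodule, a v ∈ S.toSubmodule) ∧ S.toSubmodule ≠ ⊥ ∧
          ∀ S' : SubHodgeStructure H, (∀ a ∈ H.endAlg, ∀ v ∈ S'.toSubmodule, a v ∈ S'.toSubmodule) →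
            S'.toSubmodule ≤ S.toSubmodule → S'.toSubmodule = ⊥ ∨ S'.toSubmodule = S.toSubmodule} → ℤˣ),
      Function.Injective f ∧
        ∀ (γ : Subgroup.center H.hodgeGroup) (S : {S : SubHodgeStructure H // (∀ a ∈ H.endAlg, ∀ v ∈ S.toSubmodule,
          a v ∈ S.toSubmodule) ∧ S.toSubmodule ≠ ⊥ ∧ ∀ S' : SubHodgeStructure H, (∀ a ∈ H.endAlg, ∀ v ∈ S'.toSubmodule,
            a v ∈ S'.toSubmodule) → S'.toSubmodule ≤ S.toSubmodule → S'.toSubmodule = ⊥ ∨ S'.toSubmodule = S.toSubmodule}),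
          ∀ v ∈ (S : SubHodgeStructure H).toSubmodule,
            (((γ : Subgroup.center H.hodgeGroup) : H.hodgeGroup) : V ≃ₗ[ℚ] V) v = ((f γ S : ℤˣ) : ℤ) • v := by
  obtain ⟨i, hi, hiγ⟩ := ψ.exists_center_hodgeGroup_monoidHom_injective
  obtain ⟨e, he⟩ := ψ.exists_mulEquiv_center_lefschetzGroup_pi_units hfix
  refine ⟨e.toMonoidHom.comp i, e.injective.comp hi, fun γ S v hv => ?_⟩
  rw [← hiγ γ, MonoidHom.comp_apply, MulEquiv.coe_toMonoidHom]
  exact he (i γ) S v hv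

end HodgeGroup

end HodgeStructure

end Literature.AlgebraicGeometry.Motives
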